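import Summits.KontsevichZagierPeriods.KontsevichZagierPeriods.Theorems.SymplecticScissorsVolumeFormOffPlaneSimplexPairs

/-!
# `VolumeFormOffPlane` (stmt-KontsevichZagierPeriods-14935) — line `Sketch`,
stub `stub_polygonPairs` (the mixed polygon-cell sector in dimension `3`, PAIR FORM)

Pure bookkeeping. Given
(1) the generic finite disjoint-union splitter of the Kontsevich–Zagier calculus (the registered
    conclusion of the sibling stub `stub_unionSplit`, taken here as a hypothesis): if the domain of
    an integrand-`1` representation `r` is the disjoint union of the domains of integrand-`1`
    representations `R i`, then `[r] − ∑ᵢ [R i]` is a relation and the values add up; and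
(2) the mixed polygon-cell sector in dimension `3` in FAMILY FORM (the registered conclusion of
    `stub_mixedSector`): two mixed finite families of log-boxes and log-triangles with equal total
    value are KZ-equivalent as formal sums;
we derive the PAIR FORM: two integrand-`1` representations `r`, `r'` of dimension `3` whose
domains are finite disjoint unions of such boxes and triangles and whose values agree are
KZ-equivalent.

Proof: concatenate the boxes and the triangles of one side into ONE family indexed by
`Fin (k + m)` and split `r` along it by (1) — this is `spr_side` of the sibling file
`SymplecticScissorsVolumeFormOffPlaneSimplexPairs.lean` (the all-dimension twin), which also
computes `r.value` as the total value of the family by soundness; do the same for `r'`, feed (2)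
with the resulting equality of total values, and add the three relations. Shape-generic analogue
of `toric_sector_pairs` (`SymplecticScissorsVolumeFormOffPlaneToricF.lean`, boxes only).

Sources: Kontsevich–Zagier 2001, §1.2 (the moves and their soundness).
-/

noncomputable section

open MeasureTheory Set
open Literature.NumberTheory.Transcendental

namespace Summit.KontsevichZagierPeriods.SymplecticScissors.LogPolytope

/-- **Stub (the mixed polygon-cell sector in dimension `3`, pair form; bookkeeping).** Given the
generic finite disjoint-union splitter of the KZ calculus and the family form of the mixed
polygon-cell sector: for `α, β > 0` real algebraic and multiplicatively independent, two
integrand-`1` representations of dimension `3` whose domains are finite disjoint unions of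
log-boxes (real-algebraic position, edge ratios in `α^ℚ β^ℚ`, `> 1`) and log-triangles
(`c = aⁱbʲ·α^u β^v`, ratio `> 1`) and whose values agree are KZ-equivalent (split both sides along
the concatenated families, compare total values by soundness, apply the family form). [folklore] -/
theorem stub_polygonPairs : (∀ (N k : ℕ) (r : KZ.IntegralRep N) (R : Fin k → KZ.IntegralRep N), r.domain = ⋃ i, (R i).domain → (∀ i j, i ≠ j → Disjoint (R i).domain (R j).domain) → (∀ p ∈ r.domain, r.integrand p = 1) → (∀ i, ∀ p ∈ (R i).domain, (R i).integrand p = 1) → KZ.of r - ∑ i, KZ.of (R i) ∈ KZ.relations ∧ r.value = ∑ i, (R i).value) → (∀ (α β : ℝ), 0 < α → 0 < β → IsAlgebraic ℚ α → IsAlgebraic ℚ β → (∀ p q : ℤ, α ^ p * β ^ q = 1 → p = 0 ∧ q = 0) → ∀ (k m k' m' : ℕ) (a : Fin k → Fin 2 → ℝ) (u v : Fin k → Fin 2 → ℚ) (ta tb tc : Fin m → ℝ) (ti tj : Fin m → ℕ) (tu tv : Fin m → ℚ) (a' : Fin k' → Fin 2 → ℝ) (u' v' : Fin k' → Fin 2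 → ℚ) (ta' tb' tc' : Fin m' → ℝ) (ti' tj' : Fin m' → ℕ) (tu' tv' : Fin m' → ℚ) (rB : Fin k → KZ.IntegralRep 3) (rT : Fin m → KZ.IntegralRep 3) (rB' : Fin k' → KZ.IntegralRep 3) (rT' : Fin m' → KZ.IntegralRep 3), (∀ i j, 0 < a i j) → (∀ i j, IsAlgebraic ℚ (a i j)) → (∀ i j, 1 < α ^ ((u i j : ℚ) : ℝ) * β ^ ((v i j : ℚ) : ℝ)) → (∀ i, (rB i).domain = {p : Fin (2 + 1) → ℝ | (∀ j : Fin 2, a i j < p (Fin.castSucc j) ∧ p (Fin.castSucc j) < a i j * (α ^ ((u i j : ℚ) : ℝ) * β ^ ((v i j : ℚ) : ℝ))) ∧ 0 < p (Fin.last 2) ∧ p (Fin.last 2) * ∏ j : Fin 2, p (Fin.castSucc j) < 1}) → (∀ i, ∀ p ∈ (rB i).domain, (rB i).integrand p = 1) → (∀ ν, 0 < ta ν) → (∀ ν, 0 < tb ν) → (∀ ν, IsAlgebraic ℚ (ta ν)) → (∀ ν, IsAlgebraic ℚ (tb ν)) → (∀ ν, IsAlgebraic ℚ (tc ν)) → (∀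 ν, 1 ≤ ti ν) → (∀ ν, 1 ≤ tj ν) → (∀ ν, tc ν = ta ν ^ ti ν * tb ν ^ tj ν * (α ^ ((tu ν : ℚ) : ℝ) * β ^ ((tv ν : ℚ) : ℝ))) → (∀ ν, 1 < α ^ ((tu ν : ℚ) : ℝ) * β ^ ((tv ν : ℚ) : ℝ)) → (∀ ν, (rT ν).domain = {p : Fin 3 → ℝ | ta ν < p 0 ∧ tb ν < p 1 ∧ p 0 ^ ti ν * p 1 ^ tj ν < tc ν ∧ 0 < p 2 ∧ p 2 * (p 0 * p 1) < 1}) → (∀ ν, ∀ p ∈ (rT ν).domain, (rT ν).integrand p = 1) → (∀ i j, 0 < a' i j) → (∀ i j, IsAlgebraic ℚ (a' i j)) → (∀ i j, 1 < α ^ ((u' i j : ℚ) : ℝ) * β ^ ((v' i j : ℚ) : ℝ)) → (∀ i, (rB' i).domain = {p : Fin (2 + 1) → ℝ | (∀ j : Fin 2, a' i j < p (Fin.castSucc j) ∧ p (Fin.castSucc j) < a' i j * (α ^ ((u' i j : ℚ) : ℝ) * β ^ ((v' i j : ℚ) : ℝ))) ∧ 0 < p (Fin.last 2) ∧ p (Fin.last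 2) * ∏ j : Fin 2, p (Fin.castSucc j) < 1}) → (∀ i, ∀ p ∈ (rB' i).domain, (rB' i).integrand p = 1) → (∀ ν, 0 < ta' ν) → (∀ ν, 0 < tb' ν) → (∀ ν, IsAlgebraic ℚ (ta' ν)) → (∀ ν, IsAlgebraic ℚ (tb' ν)) → (∀ ν, IsAlgebraic ℚ (tc' ν)) → (∀ ν, 1 ≤ ti' ν) → (∀ ν, 1 ≤ tj' ν) → (∀ ν, tc' ν = ta' ν ^ ti' ν * tb' ν ^ tj' ν * (α ^ ((tu' ν : ℚ) : ℝ) * β ^ ((tv' ν : ℚ) : ℝ))) → (∀ ν, 1 < α ^ ((tu' ν : ℚ) : ℝ) * β ^ ((tv' ν : ℚ) : ℝ)) → (∀ ν, (rT' ν).domain = {p : Fin 3 → ℝ | ta' ν < p 0 ∧ tb' ν < p 1 ∧ p 0 ^ ti' ν * p 1 ^ tj' ν < tc' ν ∧ 0 < p 2 ∧ p 2 * (p 0 * p 1) < 1}) → (∀ ν, ∀ p ∈ (rT' ν).domain, (rT' ν).integrand p = 1) → ∑ ν, (rB ν).value + ∑ ν, (rT ν).value = ∑ ν, (rB' ν).value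 + ∑ ν, (rT' ν).value → (∑ ν, KZ.of (rB ν) + ∑ ν, KZ.of (rT ν)) - (∑ ν, KZ.of (rB' ν) + ∑ ν, KZ.of (rT' ν)) ∈ KZ.relations) → (∀ (α β : ℝ), 0 < α → 0 < β → IsAlgebraic ℚ α → IsAlgebraic ℚ β → (∀ p q : ℤ, α ^ p * β ^ q = 1 → p = 0 ∧ q = 0) → ∀ (k m k' m' : ℕ) (a : Fin k → Fin 2 → ℝ) (u v : Fin k → Fin 2 → ℚ) (ta tb tc : Fin m → ℝ) (ti tj : Fin m → ℕ) (tu tv : Fin m → ℚ) (a' : Fin k' → Fin 2 → ℝ) (u' v' : Fin k' → Fin 2 → ℚ) (ta' tb' tc' : Fin m' → ℝ) (ti' tj' : Fin m' → ℕ) (tu' tv' : Fin m' → ℚ) (rB : Fin k → KZ.IntegralRep 3) (rT : Fin m → KZ.IntegralRep 3) (rB' : Fin k' → KZ.IntegralRep 3) (rT' : Fin m' → KZ.IntegralRep 3) (r r' : KZ.IntegralRep 3), (∀ i j, 0 < a i j) → (∀ i j, IsAlgebraic ℚ (a i j)) → (∀ i j, 1 < α ^ ((u i j : ℚ) : ℝ)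 * β ^ ((v i j : ℚ) : ℝ)) → (∀ i, (rB i).domain = {p : Fin (2 + 1) → ℝ | (∀ j : Fin 2, a i j < p (Fin.castSucc j) ∧ p (Fin.castSucc j) < a i j * (α ^ ((u i j : ℚ) : ℝ) * β ^ ((v i j : ℚ) : ℝ))) ∧ 0 < p (Fin.last 2) ∧ p (Fin.last 2) * ∏ j : Fin 2, p (Fin.castSucc j) < 1}) → (∀ i, ∀ p ∈ (rB i).domain, (rB i).integrand p = 1) → (∀ ν, 0 < ta ν) → (∀ ν, 0 < tb ν) → (∀ ν, IsAlgebraic ℚ (ta ν)) → (∀ ν, IsAlgebraic ℚ (tb ν)) → (∀ ν, IsAlgebraic ℚ (tc ν)) → (∀ ν, 1 ≤ ti ν) → (∀ ν, 1 ≤ tj ν) → (∀ ν, tc ν = ta ν ^ ti ν * tb ν ^ tj ν * (α ^ ((tu ν : ℚ) : ℝ) * β ^ ((tv ν : ℚ) : ℝ))) → (∀ ν, 1 < α ^ ((tu ν : ℚ) : ℝ) * β ^ ((tv ν : ℚ) : ℝ)) → (∀ ν, (rT ν).domain = {p : Fin 3 → ℝ | ta ν < p 0 ∧ tb ν < p 1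 ∧ p 0 ^ ti ν * p 1 ^ tj ν < tc ν ∧ 0 < p 2 ∧ p 2 * (p 0 * p 1) < 1}) → (∀ ν, ∀ p ∈ (rT ν).domain, (rT ν).integrand p = 1) → (∀ i j, 0 < a' i j) → (∀ i j, IsAlgebraic ℚ (a' i j)) → (∀ i j, 1 < α ^ ((u' i j : ℚ) : ℝ) * β ^ ((v' i j : ℚ) : ℝ)) → (∀ i, (rB' i).domain = {p : Fin (2 + 1) → ℝ | (∀ j : Fin 2, a' i j < p (Fin.castSucc j) ∧ p (Fin.castSucc j) < a' i j * (α ^ ((u' i j : ℚ) : ℝ) * β ^ ((v' i j : ℚ) : ℝ))) ∧ 0 < p (Fin.last 2) ∧ p (Fin.last 2) * ∏ j : Fin 2, p (Fin.castSucc j) < 1}) → (∀ i, ∀ p ∈ (rB' i).domain, (rB' i).integrand p = 1) → (∀ ν, 0 < ta' ν) → (∀ ν, 0 < tb' ν) → (∀ ν, IsAlgebraic ℚ (ta' ν)) → (∀ ν, IsAlgebraic ℚ (tb' ν)) → (∀ ν, IsAlgebraic ℚ (tc' ν)) → (∀ ν, 1 ≤ ti' ν) → (∀ ν, 1 ≤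 tj' ν) → (∀ ν, tc' ν = ta' ν ^ ti' ν * tb' ν ^ tj' ν * (α ^ ((tu' ν : ℚ) : ℝ) * β ^ ((tv' ν : ℚ) : ℝ))) → (∀ ν, 1 < α ^ ((tu' ν : ℚ) : ℝ) * β ^ ((tv' ν : ℚ) : ℝ)) → (∀ ν, (rT' ν).domain = {p : Fin 3 → ℝ | ta' ν < p 0 ∧ tb' ν < p 1 ∧ p 0 ^ ti' ν * p 1 ^ tj' ν < tc' ν ∧ 0 < p 2 ∧ p 2 * (p 0 * p 1) < 1}) → (∀ ν, ∀ p ∈ (rT' ν).domain, (rT' ν).integrand p = 1) → r.domain = (⋃ i, (rB i).domain) ∪ (⋃ ν, (rT ν).domain) → (∀ i j, i ≠ j → Disjoint ((rB) i).domain ((rB) j).domain) → (∀ ν μ, ν ≠ μ → Disjoint ((rT) ν).domain ((rT) μ).domain) → (∀ i ν, Disjoint ((rB) i).domain ((rT) ν).domain) → (∀ p ∈ r.domain, r.integrand p = 1) → r'.domain = (⋃ i, (rB' i).domain) ∪ (⋃ ν, (rT' ν).domain) → (∀ i j, i ≠ j → Disjoint ((rB') i).domain ((rB') j).domain) → (∀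 ν μ, ν ≠ μ → Disjoint ((rT') ν).domain ((rT') μ).domain) → (∀ i ν, Disjoint ((rB') i).domain ((rT') ν).domain) → (∀ p ∈ r'.domain, r'.integrand p = 1) → r.value = r'.value → KZ.Equivalent r r') := by
  intro hSplit hMixed α β hα hβ hαa hβa hind k m k' m' a u v ta tb tc ti tj tu tv a' u' v' ta' tb'
    tc' ti' tj' tu' tv' rB rT rB' rT' r r' ha haa hlt hrBd hrBi hta htb htaa htba htca hti htj htc
    hltT hrTd hrTi ha' ha'a hlt' hrB'd hrB'i hta' htb' hta'a htb'a htc'a hti' htj' htc' hltT' hrT'd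
    hrT'i hrd hBB hTT hBT hri hrd' hBB' hTT' hBT' hri' hv
  -- adapted from `toric_sector_pairs` (part ToricF of this line); the splitting is `spr_side`
  obtain ⟨h₁, hv₁⟩ := spr_side hSplit r rB rT hrd hBB hTT hBT hri hrBi hrTi
  obtain ⟨h₂, hv₂⟩ := spr_side hSplit r' rB' rT' hrd' hBB' hTT' hBT' hri' hrB'i hrT'i
  have h₃ : (∑ ν, KZ.of (rB ν) + ∑ ν, KZ.of (rT ν)) - (∑ ν, KZ.of (rB' ν) + ∑ ν, KZ.of (rT' ν)) ∈
      KZ.relations :=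
    hMixed α β hα hβ hαa hβa hind k m k' m' a u v ta tb tc ti tj tu tv a' u' v' ta' tb' tc' ti' tj'
      tu' tv' rB rT rB' rT' ha haa hlt hrBd hrBi hta htb htaa htba htca hti htj htc hltT hrTd hrTi
      ha' ha'a hlt' hrB'd hrB'i hta' htb' hta'a htb'a htc'a hti' htj' htc' hltT' hrT'd hrT'i
      (by rw [← hv₁, ← hv₂, hv])
  have key : KZ.of r - KZ.of r' = (KZ.of r - (∑ ν, KZ.of (rB ν) + ∑ ν, KZ.of (rT ν))) +
      ((∑ ν, KZ.of (rB ν) + ∑ ν, KZ.of (rT ν)) - (∑ ν, KZ.of (rB' ν) + ∑ ν, KZ.of (rT' ν))) -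
      (KZ.of r' - (∑ ν, KZ.of (rB' ν) + ∑ ν, KZ.of (rT' ν))) := by
    abel
  show KZ.of r - KZ.of r' ∈ KZ.relations
  rw [key]
  exact KZ.relations.sub_mem (KZ.relations.add_mem h₁ h₃) h₂

end Summit.KontsevichZagierPeriods.SymplecticScissors.LogPolytope

end
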